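import Summits.KontsevichZagierPeriods.Zeta5Search.Barrier.ConeGammaCritFarValue
import Summits.KontsevichZagierPeriods.Zeta5Search.Barrier.ConeGammaCritBoxCert

/-!
# ζ(5) search — BARRIER: THE FAR CRITICAL POINT THROUGH INFINITY — lemmas for the certificate (a near critical point
# with its location; the pieces of the far interval; the `sSup` of three values)

HONEST FRAMING (cell `pub-zeta5`): systematic search; no irrationality claim unless kernel-certified. Auxiliary theorems for
`ConeGammaCritFarCert`: `exists_near_of_rootCheck` (cert-2 g37's near branch of `exists_isCritical_of_rootCheck`,
re-derived WITH the location `|Y|·Q ≤ |cv| + Σ|av| + wv` of the Poincaré–Miranda point), `pieceOK_sound`,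
`exists_piece` (every `z` of the far interval lies in one of the pieces, with its `ε₉`-coordinate), `sSup_three`
(`sSup {v₀,v₁,v₂} = v₂`, `sSup ({v₀,v₁,v₂} ∖ {v₂}) = max v₀ v₁` for `v₀, v₁ < v₂`). MODEL objects under BZ (28)+(30);
nothing about any γ of record, C2 (OPEN), S-E or `ζ(5)`. Theory seat cert-2 g38.
-/

noncomputable section

open Set

namespace Summit.KontsevichZagierPeriods.Zeta5Search.Barrier.ConeGamma

namespace CritFar

open Literature.Analysis.ValidatedNumerics (AForm)
open Literature.Analysis.ValidatedNumerics.AForm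
open LemmaFBox (SC SC_pos)
open CritBox


/-! ### A near critical point with its location -/

/-- `|Σ_{j<7} a_j ε_{j+1}| ≤ Σ|a_j|` for a valid noise vector and a coefficient list of length `7`. -/
theorem abs_linR_le {ε : ℕ → ℝ} (hε : Valid ε) {a : List ℤ} (ha : a.length = 7) :
    |linR a ε| ≤ (absSum a : ℝ) := by
  have b : ∀ (c : ℤ) (j : ℕ), |(c : ℝ) * ε j| ≤ ((c.natAbs : ℕ) : ℝ) := fun c j => by
    rw [abs_mul, Nat.cast_natAbs, Int.cast_abs]
    exact mul_le_of_le_one_right (abs_nonneg _) (hε j)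
  match a, ha with
  | [a0, a1, a2, a3, a4, a5, a6], _ =>
    simp only [linR, List.getD_cons_zero, List.getD_cons_succ, absSum]
    push_cast
    have e0 := b a0 1; have e1 := b a1 2; have e2 := b a2 3; have e3 := b a3 4; have e4 := b a4 5
    have e5 := b a5 6; have e6 := b a6 7
    rw [abs_le] at e0 e1 e2 e3 e4 e5 e6 ⊢
    constructor <;> linarith [e0.1, e1.1, e2.1, e3.1, e4.1, e5.1, e6.1, e0.2, e1.2, e2.2, e3.2, e4.2, e5.2, e6.2]

/-- **A NEAR critical point with its value AND its location** (g37's near branch, re-derived with the location):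
for near data (`far = false`, `av` of length 7) with `rootCheck = some (l, u)`, every box direction has a critical
point `(X + t₆, Y + t₆)` with value in `[l/SC, u/SC]` and `|Y|·Q ≤ |cv| + Σ|av| + wv`. -/
theorem exists_near_of_rootCheck {D T : ℕ} {lo hi : List ℕ} {t : Fin 8 → ℝ} (hok : boxOKc D lo hi = true)
    (hT : 0 < T) (h : t ∈ LemmaFBox.box D lo hi) (ht0 : t 0 = 1) {rd : RootData} (hfar : rd.far = false)
    (hlen : rd.av.length = 7) {l u : ℤ} (hrc : rootCheck D T lo hi rd = some (l, u)) :
    ∃ X Y : ℝ, IsCritical (aOfS t) (X + t 6) (Y + t 6) ∧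
      (l : ℝ) ≤ growthLogR (pR (aOfS t)) (qR (aOfS t)) (X + t 6) (Y + t 6) * SC ∧
      growthLogR (pR (aOfS t)) (qR (aOfS t)) (X + t 6) (Y + t 6) * SC ≤ (u : ℝ) ∧
      |Y| * ((2 * D * T : ℕ) : ℝ) ≤ ((rd.cv.natAbs + absSum rd.av + rd.wv : ℕ) : ℝ) := by
  have hD : 0 < D := by
    have := hok; simp only [boxOKc, decide_eq_true_eq] at this; exact this.1
  set Qn : ℕ := 2 * D * T with hQn
  have hQ : 0 < Qn := by rw [hQn]; exact Nat.mul_pos (Nat.mul_pos (by norm_num) hD) hT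
  unfold rootCheck at hrc
  dsimp only at hrc
  split at hrc
  · rename_i hcond
    obtain ⟨hface, _, _, hwx, hwv, _, hdet⟩ := hcond
    split at hrc
    · rename_i G hG
      simp only [Option.some.injEq, Prod.mk.injEq] at hrc
      obtain ⟨rfl, rfl⟩ := hrc
      obtain ⟨η₁, η₂, hη₁, hη₂, hzero⟩ := exists_zero_of_faceCheck hok hT h ht0 hface hwx hwv hdet
      have hv := valid_noise hok h hη₁ hη₂
      set ε := noise D lo hi t η₁ η₂ with hε
      set P := boxPt D T lo hi rd t η₁ η₂ with hP
      have htA := tAF_mem hok h ht0 hη₁ hη₂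
      have hQc : ((Qn : ℕ) : ℝ) = 2 * (D : ℝ) * T := by rw [hQn]; push_cast; ring
      have hX : mem SC ε P.1 (coordAF rd.cx rd.ax rd.wx 8 Qn) := by
        have := coordAF_mem hv rd.cx rd.ax rd.wx hQ 8 (Or.inl rfl)
        rw [hQc] at this
        simpa [hP, boxPt, hε, noise] using this
      have hV : mem SC ε P.2 (coordAF rd.cv rd.av rd.wv 9 Qn) := by
        have := coordAF_mem hv rd.cv rd.av rd.wv hQ 9 (Or.inr rfl)
        rw [hQc] at this
        simpa [hP, boxPt, hε, noise] using this
      unfold valueAF at hG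
      rw [hfar] at hG hzero
      simp only [Bool.false_eq_true, if_false] at hG
      have hF := forall₂_zip (coefs_forall₂ htA) (argsNear_forall₂ htA hX hV)
      have hall := List.rel_append hF (constTerms_forall₂ htA)
      obtain ⟨hne, hmem⟩ := logSum_mem hv _ _ hall hG
      refine ⟨P.1, P.2, ⟨?_, ?_, ?_⟩, ?_, ?_, ?_⟩
      · have := congrArg Prod.fst hzero; simpa [sysR] using this
      · have := congrArg Prod.snd hzero; simpa [sysR] using this
      · intro k
        rw [critFactors_near]
        have hlen12 : (argsNearR t P.1 P.2).length = 12 := by simp [argsNearR]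
        have hmemk : (argsNearR t P.1 P.2).getD k 0 ∈ argsNearR t P.1 P.2 := by
          rw [List.getD_eq_getElem _ _ (by rw [hlen12]; exact k.isLt)]
          exact List.getElem_mem _
        have hlenc : (coefsR t).length = 12 := by simp [coefsR]
        obtain ⟨i, hi, hgi⟩ := List.getElem_of_mem hmemk
        have hz : ((coefsR t)[i]'(by rw [hlenc]; rw [hlen12] at hi; exact hi), (argsNearR t P.1 P.2)[i]) ∈
            ((coefsR t).zip (argsNearR t P.1 P.2)) ++ constTermsR t := by
          apply List.mem_append_left
          rw [List.mem_iff_getElem]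
          refine ⟨i, by simp [hlenc, hlen12]; rw [hlen12] at hi; exact hi, ?_⟩
          simp
        have := hne _ hz
        simpa [hgi] using this
      · rw [growthLogR_near]; exact lo_le hv hmem
      · rw [growthLogR_near]; exact le_hi hv hmem
      · -- location: `P.2 = (cv + Σ av_j ε_j + wv η₂)/Q`
        have hP2 : P.2 = ((rd.cv : ℝ) + linR rd.av ε + rd.wv * η₂) / (Qn : ℝ) := by
          simp [hP, boxPt, coordR, hε, hQn]
        have hQr : (0 : ℝ) < Qn := by exact_mod_cast hQ
        rw [hP2, abs_div, abs_of_pos hQr, div_mul_cancel₀ _ hQr.ne']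
        have h1 := abs_linR_le hv hlen
        have h2 : |(rd.wv : ℝ) * η₂| ≤ rd.wv := by
          rw [abs_mul, abs_of_nonneg (by positivity : (0 : ℝ) ≤ rd.wv)]
          exact mul_le_of_le_one_right (by positivity) hη₂
        have h3 : |(rd.cv : ℝ)| = ((rd.cv.natAbs : ℕ) : ℝ) := by rw [Nat.cast_natAbs, Int.cast_abs]
        push_cast
        rw [← h3]
        exact (abs_add_le _ _).trans (add_le_add ((abs_add_le _ _).trans (add_le_add le_rfl h1)) h2)
    · exact absurd hrc (by simp)
  · exact absurd hrc (by simp)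

/-! ### The pieces -/

/-- `encOK vlo vhi r` ⇒ `r = some G` with `vlo ≤ G.lo`, `G.hi ≤ vhi`. -/
theorem encOK_sound {vlo vhi : ℤ} {r : Option AForm} (h : encOK vlo vhi r = true) :
    ∃ G, r = some G ∧ vlo ≤ AForm.lo G ∧ AForm.hi G ≤ vhi := by
  cases r with
  | none => simp [encOK] at h
  | some G =>
    simp only [encOK, decide_eq_true_eq] at h
    exact ⟨G, rfl, h.1, h.2⟩

/-- `pieceOK … j` ⇒ piece `j` evaluates with its enclosure inside `[vlo, vhi]`. -/
theorem pieceOK_sound {D : ℕ} {lo hi : List ℕ} {fd : FarData} {j : ℕ} (h : pieceOK D lo hi fd j = true) :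
    ∃ G, farValueAF (tAF D lo hi) (zPieceAF fd j) = some G ∧ fd.vlo ≤ AForm.lo G ∧ AForm.hi G ≤ fd.vhi :=
  encOK_sound h

/-- Every `z` of the far interval lies in some piece: `z = (c_j + w·η)/(2m·zden)` with `|η| ≤ 1`, matching
`zPieceAF fd j` (`c_j = 2m·zlo + (2j+1)(zhi−zlo)`, `w = zhi − zlo`). -/
theorem exists_piece {fd : FarData} (hzden : 0 < fd.zden) (hlt : fd.zlo < fd.zhi) (hm : 0 < fd.pieces) {z : ℝ}
    (hz : z ∈ Ioo ((fd.zlo : ℝ) / fd.zden) ((fd.zhi : ℝ) / fd.zden)) :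
    ∃ j < fd.pieces, ∃ η : ℝ, |η| ≤ 1 ∧
      z = ((2 * (fd.pieces : ℤ) * fd.zlo + (2 * (j : ℤ) + 1) * (fd.zhi - fd.zlo) : ℤ) + 0
        + ((fd.zhi - fd.zlo).toNat : ℕ) * η) / ((2 * fd.pieces * fd.zden : ℕ) : ℝ) := by
  have hzd : (0 : ℝ) < fd.zden := by exact_mod_cast hzden
  have hw : (0 : ℝ) < (fd.zhi : ℝ) - fd.zlo := by
    have : ((fd.zlo : ℤ) : ℝ) < fd.zhi := by exact_mod_cast hlt
    linarith
  have hmr : (0 : ℝ) < fd.pieces := by exact_mod_cast hm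
  set u : ℝ := (z * fd.zden - fd.zlo) / (fd.zhi - fd.zlo) with hu
  have hu0 : 0 < u := by
    rw [hu]; apply div_pos _ hw
    have := hz.1; rw [div_lt_iff₀ hzd] at this; linarith
  have hu1 : u < 1 := by
    rw [hu, div_lt_one hw]
    have := hz.2; rw [lt_div_iff₀ hzd] at this; linarith
  set j : ℕ := ⌊(fd.pieces : ℝ) * u⌋₊ with hj
  have hmu0 : 0 ≤ (fd.pieces : ℝ) * u := by positivity
  have hjle : (j : ℝ) ≤ fd.pieces * u := Nat.floor_le hmu0
  have hjlt : (fd.pieces : ℝ) * u < j + 1 := Nat.lt_floor_add_one _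
  have hjm : j < fd.pieces := by
    have : (j : ℝ) < fd.pieces := lt_of_le_of_lt hjle (by nlinarith)
    exact_mod_cast this
  refine ⟨j, hjm, 2 * ((fd.pieces : ℝ) * u - j) - 1, ?_, ?_⟩
  · rw [abs_le]; constructor <;> linarith
  · have htoNat : (((fd.zhi - fd.zlo).toNat : ℕ) : ℝ) = (fd.zhi : ℝ) - fd.zlo := by
      have : (0 : ℤ) ≤ fd.zhi - fd.zlo := by omega
      rw [show (((fd.zhi - fd.zlo).toNat : ℕ) : ℝ) = (((fd.zhi - fd.zlo).toNat : ℤ) : ℝ) by norm_cast,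
        Int.toNat_of_nonneg this]
      push_cast; ring
    rw [htoNat]
    have hden : ((2 * fd.pieces * fd.zden : ℕ) : ℝ) ≠ 0 := by positivity
    rw [eq_div_iff hden]
    push_cast
    have : u * ((fd.zhi : ℝ) - fd.zlo) = z * fd.zden - fd.zlo := by rw [hu]; field_simp
    nlinarith [this]

/-! ### Identification under `Regular` -/

/-- `sSup {v₀, v₁, v₂} = v₂` and `sSup ({v₀, v₁, v₂} \ {v₂}) = max v₀ v₁` when `v₀, v₁ < v₂`. -/
theorem sSup_three {v₀ v₁ v₂ : ℝ} (h0 : v₀ < v₂) (h1 : v₁ < v₂) :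
    sSup ({v₀, v₁, v₂} : Set ℝ) = v₂ ∧ sSup (({v₀, v₁, v₂} : Set ℝ) \ {v₂}) = max v₀ v₁ := by
  constructor
  · apply le_antisymm
    · refine csSup_le (Set.insert_nonempty _ _) ?_
      rintro x (rfl | rfl | rfl)
      · exact h0.le
      · exact h1.le
      · exact le_rfl
    · exact le_csSup ((Set.toFinite _).bddAbove) (by simp)
  · have hset : (({v₀, v₁, v₂} : Set ℝ) \ {v₂}) = {v₀, v₁} := by
      ext x
      simp only [Set.mem_sdiff, Set.mem_insert_iff, Set.mem_singleton_iff]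
      constructor
      · rintro ⟨hx | hx | hx, hne⟩
        · exact Or.inl hx
        · exact Or.inr hx
        · exact absurd hx hne
      · rintro (hx | hx)
        · exact ⟨Or.inl hx, by rw [hx]; exact h0.ne⟩
        · exact ⟨Or.inr (Or.inl hx), by rw [hx]; exact h1.ne⟩
    rw [hset]
    apply le_antisymm
    · refine csSup_le (Set.insert_nonempty _ _) ?_
      rintro x (rfl | rfl)
      · exact le_max_left _ _
      · exact le_max_right _ _
    · rcases le_total v₀ v₁ with hle | hle
      · rw [max_eq_right hle]; exact le_csSup ((Set.toFinite _).bddAbove) (by simp)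
      · rw [max_eq_left hle]; exact le_csSup ((Set.toFinite _).bddAbove) (by simp)

end CritFar

end Summit.KontsevichZagierPeriods.Zeta5Search.Barrier.ConeGamma

end
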